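import Summits.AtomisticToContinuum.HydrodynamicLimit.Theorems.InfluenceLocality.Negative.ContactPerturbation
import Summits.AtomisticToContinuum.HydrodynamicLimit.Theorems.InfluenceLocality.Negative.PhaseScript
import HarnessLib

/-!
# No late incoming contact (registered stub `stub_contactLate`, refutation line
# `ignition-cascade-refutation`, crux `InfluenceLocality`, stmt-AtomisticToContinuum-13916)

Companion of Negative/ContactPerturbation.lean (same notation). A mover–target pair has relative position
`q` and relative velocity `u`; its free relative motion is `p(t) = q + t u` and a contact is `‖p(t)‖ = ε`.
Nominal data `(q₀, u₀)` reach the contact sphere of radius `ε` at time `t₀` with impact vector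
`n₀ = q₀ + t₀ u₀`, incoming with margin `κ` (`⟪n₀, u₀⟫ ≤ -κ ε ‖u₀‖`), and the actual data deviate from the
nominal free motion by at most `D` in position at the overlap time `σ = t₀ + 2D/(κ‖u₀‖)`, `0 < D < κ² ε / 4`.

* `contactPerturbation_noEarly` (landed) excludes contacts strictly before `t₀ - 2D/(κ‖u₀‖)`;
* `contactPerturbation_overlap` (landed) gives the overlap `‖p(σ)‖ < ε`;
* `contactLate_inner_pos` / `stub_contactLate` (this file): any contact `‖p(t)‖ = ε` at a time `t > σ`
  is OUTGOING, `0 < ⟪p(t), u⟫`.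

The proof is the convexity of the quadratic `s ↦ ‖p(s)‖²`: writing `p(σ) = p(t) + (σ - t) u`,
`‖p(σ)‖² = ε² + 2 (σ - t) ⟪p(t), u⟫ + (σ - t)² ‖u‖² < ε²` with `σ - t < 0` forces `⟪p(t), u⟫ > 0`.
Design-independent; asserts no Theses decl.
-/

namespace Summit.AtomisticToContinuum.HydrodynamicLimit.Theorems.InfluenceLocality.Negative

open MeasureTheory Set
open scoped InnerProductSpace
open Literature.Analysis.FluidPDE Literature.MathematicalPhysics.KineticTheory
open Literature.Analysis.FunctionSpaces

noncomputable section

/-- Sign of a contact after an overlap (real inner product space). If the free motion `q + s u` is strictly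
inside the sphere of radius `ε` at time `σ` and on it at a later time `t > σ`, then the contact at `t` is
outgoing: `0 < ⟪q + t u, u⟫`. Indeed `‖q + σ u‖² = ε² + 2 (σ - t) ⟪q + t u, u⟫ + (σ - t)² ‖u‖² < ε²`. -/
theorem contactLate_inner_pos_of_overlap {E : Type*} [NormedAddCommGroup E] [InnerProductSpace ℝ E]
    {q u : E} {ε σ t : ℝ} (hover : ‖q + σ • u‖ < ε) (hσt : σ < t) (hct : ‖q + t • u‖ = ε) :
    0 < ⟪q + t • u, u⟫_ℝ := by
  have hdec : q + σ • u = (q + t • u) + (σ - t) • u := by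
    rw [sub_smul]; abel
  have hsq : ‖q + σ • u‖ ^ 2 < ε ^ 2 := by
    have h0 : 0 ≤ ‖q + σ • u‖ := norm_nonneg _
    exact pow_lt_pow_left₀ hover h0 two_ne_zero
  rw [hdec, contactPerturbation_norm_add_smul_sq, hct] at hsq
  -- `2 (σ - t) ⟪p(t), u⟫ + (σ - t)² ‖u‖² < 0`, hence `(σ - t) ⟪p(t), u⟫ < 0` with `σ - t < 0`
  have hneg : (σ - t) * ⟪q + t • u, u⟫_ℝ < 0 := by
    nlinarith [sq_nonneg ((σ - t) * ‖u‖)]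
  exact pos_of_mul_neg_right hneg (by linarith)

/-- Sign of a late contact of the perturbed designed pair (general real inner product space): under the
hypotheses of `contactPerturbation_overlap` (nominal contact `‖q₀ + t₀ u₀‖ = ε` incoming with margin `κ`,
deviation `≤ D` at the overlap time `σ = t₀ + 2D/(κ‖u₀‖)`, `0 < D < κ² ε / 4`), any contact `‖q + t u‖ = ε`
with `σ < t` satisfies `0 < ⟪q + t u, u⟫`. -/
theorem contactLate_inner_pos {E : Type*} [NormedAddCommGroup E] [InnerProductSpace ℝ E]
    {q₀ u₀ q u : E} {ε κ t₀ D t : ℝ} (hε : 0 < ε) (hκ : 0 < κ) (hκ1 : κ ≤ 1) (hu₀ : u₀ ≠ 0)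
    (hcontact : ‖q₀ + t₀ • u₀‖ = ε) (hin : ⟪q₀ + t₀ • u₀, u₀⟫_ℝ ≤ -(κ * ε * ‖u₀‖))
    (hD : 0 < D) (hDsmall : D < κ ^ 2 * ε / 4)
    (hdev : ‖(q - q₀) + (t₀ + 2 * D / (κ * ‖u₀‖)) • (u - u₀)‖ ≤ D)
    (ht : t₀ + 2 * D / (κ * ‖u₀‖) < t) (hct : ‖q + t • u‖ = ε) :
    0 < ⟪q + t • u, u⟫_ℝ :=
  contactLate_inner_pos_of_overlap
    (contactPerturbation_overlap hε hκ hκ1 hu₀ hcontact hin hD hDsmall hdev) ht hct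

/-- NO LATE INCOMING CONTACT (registered stub (T5) of the skeleton of `IgnitionTemplates`; complements
`contactPerturbation_noEarly`). In `V3 = ℝ³`: if the nominal relative motion `q₀ + t u₀` reaches the sphere
of radius `ε` at `t₀` incoming with margin `κ` (`⟪q₀ + t₀ u₀, u₀⟫ ≤ -κ ε ‖u₀‖`), and the deviation of the
perturbed motion at the overlap time `t₀ + 2D/(κ‖u₀‖)` is `≤ D` (`0 < D < κ² ε / 4`), then any contact
`‖q + t u‖ = ε` strictly after `t₀ + 2D/(κ‖u₀‖)` is outgoing, `0 < ⟪q + t u, u⟫`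
(`contactPerturbation_overlap` + convexity of `t ↦ ‖q + t u‖²`). -/
theorem stub_contactLate :
    ∀ (q₀ u₀ q u : V3) (ε κ t₀ D t : ℝ),
    0 < ε → 0 < κ → κ ≤ 1 → u₀ ≠ 0 → ‖q₀ + t₀ • u₀‖ = ε → ⟪q₀ + t₀ • u₀, u₀⟫_ℝ ≤ -(κ * ε * ‖u₀‖) →
    0 < D → D < κ ^ 2 * ε / 4 →
    ‖(q - q₀) + (t₀ + 2 * D / (κ * ‖u₀‖)) • (u - u₀)‖ ≤ D → t₀ + 2 * D / (κ * ‖u₀‖) < t → ‖q + t • u‖ = ε →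
    0 < ⟪q + t • u, u⟫_ℝ :=
  fun _ _ _ _ _ _ _ _ _ hε hκ hκ1 hu₀ hcontact hin hD hDsmall hdev ht hct =>
    contactLate_inner_pos hε hκ hκ1 hu₀ hcontact hin hD hDsmall hdev ht hct

end

end Summit.AtomisticToContinuum.HydrodynamicLimit.Theorems.InfluenceLocality.Negative
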